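import Literature.IUT.HodgeTheaters.Conventions
import Mathlib.CategoryTheory.SingleObj
import HarnessLib

/-!
# [IUTchI] §0 "Monoids and Categories" (p. 33): composition of "isomorphisms of categories", the set
# `Isom(C₁, C₂)`, the group `Aut(C)`, and the natural map `Isom(−) → Isom(Base(−))` of Corollary 5.3

S. Mochizuki, *Inter-universal Teichmüller theory I*, kurims manuscript (May 2020), §0 "Monoids and
Categories", p. 33: *"We shall refer to an isomorphism class of equivalences between two categories as
an isomorphism between the two categories in question"*; §5, Corollary 5.3, p. 144: (i) *"the natural map
`Isom(¹ℱ^⊛, ²ℱ^⊛) → Isom(Base(¹ℱ^⊛), Base(²ℱ^⊛))` … is bijective"*, (ii) *"the natural map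
`Isom(¹𝔉, ²𝔉) → Isom(¹𝔇, ²𝔇)` is bijective"*, (iv) *"the natural homomorphism `Aut(ℱ̲_v) → Aut(𝒟_v)` … is
bijective"* ([IUTchI] §0 p.33) [claim: Mochizuki2012, status: disputed] (D-0012 claim key, status
DISPUTED — this file is §0 VOCABULARY; nothing of the series is asserted, no side is taken on [IUTchIII]
Cor. 3.12).

abc-iut-L5-t1's `Conventions.lean` typed the printed "isomorphism `C → D`" as `CatIsomorphism C D`
(an isomorphism class of equivalences), with `mk` and `mk_eq_mk_iff` only.  The rigidity statements of
[IUTchI] §5 concern the SETS `Isom(C₁, C₂)`, the GROUPS `Aut(C)` and the "natural maps" between them induced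
by a category-theoretic passage `C ↦ Base(C)` ([FrdI] Thm 3.4 / Cor 4.11).  This companion (new file; the
landed one untouched) supplies: `CatIsomorphism.comp/refl/symm` with their laws; the group `CatAut C`
(instance on the tree's own type) and the one-object kind `SingleObj (CatAut C)`; the relation
`LiesUnder p₁ p₂ Ψ Θ` («`Θ` lies under `Ψ`»: `Ψ ⋙ p₂ ≅ p₁ ⋙ Θ`, the datum of [FrdI] Cor 4.11 (iv)); and, under
the two DISPLAYED binders `HasUnder` (existence, = Cor 4.11 (i)) and `UnderUnique` (uniqueness up to
isomorphism, = Cor 4.11 (iv)), the natural map `descend : Isom(C₁, C₂) → Isom(D₁, D₂)` with `descend_comp`,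
`descend_refl`, the homomorphism `descendHom : Aut(C) →* Aut(D)`, the functor of kinds `kindFunctor`, the
predicate `DescendBijective` (Cor 5.3's "is bijective", with parameters — not a named fact) and the two
criteria `descend_injective_of_rigid` / `descend_surjective_of_lifts`.  Nothing of the series is asserted.
Written for the «genuine ℱ-prime-strip kit» hub (HOME/staging/L5/L5-t4/g6/SUBDAG-IUTchI-Cor53.md §T,
STEP0-GenuineFKit-OneObject-g6.md): kinds := `SingleObj (CatAut X)` of the REAL local Frobenioids, slot
functors := `kindFunctor`.
-/

namespace Literature.IUT.HodgeTheaters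

open CategoryTheory

universe v₁ v₂ v₃ v₄ v₅ v₆ u₁ u₂ u₃ u₄ u₅ u₆

/-! ### Isomorphic equivalences: whiskering lemmas -/

namespace CatIsomorphism

section Comp

variable {C : Type u₁} [Category.{v₁} C] {D : Type u₂} [Category.{v₂} D] {E : Type u₃} [Category.{v₃} E]
  {E' : Type u₄} [Category.{v₄} E']

/-- Composition of equivalences respects isomorphism of (the functors of) equivalences
(§0 p. 33: isomorphism classes of equivalences compose). ([IUTchI] §0 p.33) [claim: Mochizuki2012, status: disputed] -/
theorem trans_sound {e e' : C ≌ D} {f f' : D ≌ E} (he : Nonempty (e.functor ≅ e'.functor))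
    (hf : Nonempty (f.functor ≅ f'.functor)) :
    Nonempty ((e.trans f).functor ≅ (e'.trans f').functor) := by
  obtain ⟨i⟩ := he
  obtain ⟨j⟩ := hf
  exact ⟨Functor.isoWhiskerRight i f.functor ≪≫ Functor.isoWhiskerLeft e'.functor j⟩

/-- Inversion of equivalences respects isomorphism of equivalences (the inverse of an equivalence is
determined up to isomorphism by its functor). ([IUTchI] §0 p.33) [claim: Mochizuki2012, status: disputed] -/
theorem symm_sound {e e' : C ≌ D} (he : Nonempty (e.functor ≅ e'.functor)) :
    Nonempty (e.symm.functor ≅ e'.symm.functor) := by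
  obtain ⟨i⟩ := he
  exact ⟨Iso.isoInverseOfIsoFunctor i⟩

/-- **Composition of isomorphisms of categories** (§0 p. 33): the class of `Ψ` followed by the class of
`Ψ'` is the class of `Ψ.trans Ψ'` (diagrammatic order, as for functors).
([IUTchI] §0 p.33) [claim: Mochizuki2012, status: disputed] -/
def comp (a : CatIsomorphism C D) (b : CatIsomorphism D E) : CatIsomorphism C E :=
  Quotient.map₂ (sa := equivSetoid C D) (sb := equivSetoid D E) (sc := equivSetoid C E)
    (fun e f => e.trans f) (fun _ _ he _ _ hf => trans_sound he hf) a b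

/-- The identity isomorphism of categories `C → C` (class of `𝟭`). ([IUTchI] §0 p.33) [claim: Mochizuki2012, status: disputed] -/
def refl (C : Type u₁) [Category.{v₁} C] : CatIsomorphism C C := CatIsomorphism.mk (CategoryTheory.Equivalence.refl (C := C))

/-- The inverse isomorphism of categories (class of the inverse equivalence).
([IUTchI] §0 p.33) [claim: Mochizuki2012, status: disputed] -/
def symm (a : CatIsomorphism C D) : CatIsomorphism D C :=
  Quotient.map (sa := equivSetoid C D) (sb := equivSetoid D C) (fun e => e.symm)
    (fun _ _ he => symm_sound he) a

/-- `comp` on representatives. ([IUTchI] §0 p.33) [claim: Mochizuki2012, status: disputed] -/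
@[simp] theorem mk_comp_mk (e : C ≌ D) (f : D ≌ E) :
    (CatIsomorphism.mk e).comp (CatIsomorphism.mk f) = CatIsomorphism.mk (e.trans f) := rfl

/-- `symm` on representatives. ([IUTchI] §0 p.33) [claim: Mochizuki2012, status: disputed] -/
@[simp] theorem symm_mk (e : C ≌ D) : (CatIsomorphism.mk e).symm = CatIsomorphism.mk e.symm := rfl

/-- `refl` is the class of the identity equivalence. ([IUTchI] §0 p.33) [claim: Mochizuki2012, status: disputed] -/
theorem refl_eq_mk : refl C = CatIsomorphism.mk (CategoryTheory.Equivalence.refl (C := C)) := rfl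

/-- Every isomorphism of categories is the class of an equivalence. ([IUTchI] §0 p.33) [claim: Mochizuki2012, status: disputed] -/
theorem mk_surjective : Function.Surjective (CatIsomorphism.mk (C := C) (D := D)) :=
  Quotient.mk_surjective

/-- Two classes are equal iff some (any) representatives have isomorphic functors.
([IUTchI] §0 p.33) [claim: Mochizuki2012, status: disputed] -/
theorem sound {e e' : C ≌ D} (i : e.functor ≅ e'.functor) : CatIsomorphism.mk e = CatIsomorphism.mk e' :=
  (CatIsomorphism.mk_eq_mk_iff e e').2 ⟨i⟩

/-- Associativity of composition of isomorphisms of categories. ([IUTchI] §0 p.33) [claim: Mochizuki2012, status: disputed] -/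
theorem comp_assoc (a : CatIsomorphism C D) (b : CatIsomorphism D E) (c : CatIsomorphism E E') :
    (a.comp b).comp c = a.comp (b.comp c) := by
  obtain ⟨e, rfl⟩ := mk_surjective a
  obtain ⟨f, rfl⟩ := mk_surjective b
  obtain ⟨g, rfl⟩ := mk_surjective c
  simp only [mk_comp_mk]
  exact sound (Functor.associator e.functor f.functor g.functor)

/-- Left identity. ([IUTchI] §0 p.33) [claim: Mochizuki2012, status: disputed] -/
@[simp] theorem refl_comp (a : CatIsomorphism C D) : (refl C).comp a = a := by
  obtain ⟨e, rfl⟩ := mk_surjective a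
  rw [refl_eq_mk, mk_comp_mk]
  exact sound e.functor.leftUnitor

/-- Right identity. ([IUTchI] §0 p.33) [claim: Mochizuki2012, status: disputed] -/
@[simp] theorem comp_refl (a : CatIsomorphism C D) : a.comp (refl D) = a := by
  obtain ⟨e, rfl⟩ := mk_surjective a
  rw [refl_eq_mk, mk_comp_mk]
  exact sound e.functor.rightUnitor

/-- An isomorphism of categories followed by its inverse is the identity (unit of the equivalence).
([IUTchI] §0 p.33) [claim: Mochizuki2012, status: disputed] -/
@[simp] theorem comp_symm (a : CatIsomorphism C D) : a.comp a.symm = refl C := by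
  obtain ⟨e, rfl⟩ := mk_surjective a
  rw [symm_mk, mk_comp_mk, refl_eq_mk]
  exact sound e.unitIso.symm

/-- The inverse followed by the isomorphism is the identity (counit). ([IUTchI] §0 p.33) [claim: Mochizuki2012, status: disputed] -/
@[simp] theorem symm_comp (a : CatIsomorphism C D) : a.symm.comp a = refl D := by
  obtain ⟨e, rfl⟩ := mk_surjective a
  rw [symm_mk, mk_comp_mk, refl_eq_mk]
  exact sound e.counitIso

/-- `symm` is an involution. ([IUTchI] §0 p.33) [claim: Mochizuki2012, status: disputed] -/
@[simp] theorem symm_symm (a : CatIsomorphism C D) : a.symm.symm = a := by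
  obtain ⟨e, rfl⟩ := mk_surjective a
  rfl

end Comp

end CatIsomorphism

/-! ### `Aut(C)`: the group of isomorphisms of categories `C → C` -/

/-- `Aut(C)` in the sense of [IUTchI] (§0 p. 33; Cor 5.3 (iv) "`Aut(ℱ̲_v)`", "`Aut(𝒟_v)`"): the isomorphisms
of categories `C → C`, i.e. isomorphism classes of self-equivalences.
([IUTchI] §0 p.33) [claim: Mochizuki2012, status: disputed] -/
abbrev CatAut (C : Type u₁) [Category.{v₁} C] : Type (max u₁ v₁) := CatIsomorphism C C

namespace CatAut

variable (C : Type u₁) [Category.{v₁} C]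

/-- The group structure on `Aut(C)`: multiplication `a * b := b` followed by `a` (so that `a * b` acts as
"`a` after `b`", the convention of Mathlib's `End`/`Aut`), unit the class of `𝟭`, inverse the class of the
inverse equivalence.  Registered as an instance on the tree's own type `CatAut C` (no Mathlib instance exists for it;
CONVENTIONS §4 forbids only overriding/duplicating Mathlib instances). ([IUTchI] §0 p.33) [claim: Mochizuki2012, status: disputed] -/
instance group : Group (CatAut C) where
  mul a b := b.comp a
  one := CatIsomorphism.refl C
  inv a := a.symm
  mul_assoc a b c := (CatIsomorphism.comp_assoc c b a).symm
  one_mul a := CatIsomorphism.comp_refl a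
  mul_one a := CatIsomorphism.refl_comp a
  inv_mul_cancel a := CatIsomorphism.comp_symm a

/-- In `Aut(C)`, `a * b = b.comp a`. ([IUTchI] §0 p.33) [claim: Mochizuki2012, status: disputed] -/
theorem mul_def (a b : CatAut C) : a * b = b.comp a := rfl

/-- In `Aut(C)`, `1` is the class of the identity equivalence. ([IUTchI] §0 p.33) [claim: Mochizuki2012, status: disputed] -/
theorem one_def : (1 : CatAut C) = CatIsomorphism.refl C := rfl

/-- In `Aut(C)`, `a⁻¹` is the class of the inverse equivalence. ([IUTchI] §0 p.33) [claim: Mochizuki2012, status: disputed] -/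
theorem inv_def (a : CatAut C) : a⁻¹ = a.symm := rfl

end CatAut

/-! ### The natural map `Isom(C₁, C₂) → Isom(D₁, D₂)` induced by a passage `C ↦ Base(C)` -/

namespace CatIsomorphism

section Descend

variable {C₁ : Type u₁} [Category.{v₁} C₁] {C₂ : Type u₂} [Category.{v₂} C₂]
  {D₁ : Type u₃} [Category.{v₃} D₁] {D₂ : Type u₄} [Category.{v₄} D₂]

/-- "`Θ : D₁ ⥲ D₂` LIES UNDER `Ψ : C₁ ⥲ C₂`" relative to the structure functors `p₁ : C₁ → D₁`, `p₂ : C₂ → D₂`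
(e.g. a Frobenioid over its base category, [FrdI] Def 1.3; [IUTchI] Cor 5.3 "`ⁱ𝔇` the `𝒟`-prime-strip
associated to `ⁱ𝔉`"): the type of isomorphisms `Ψ ⋙ p₂ ≅ p₁ ⋙ Θ` — the 1-commutativity datum of [FrdI]
Cor 4.11 (iv). ([IUTchI] Cor 5.3 p.144) [claim: Mochizuki2012, status: disputed] -/
def LiesUnder (p₁ : C₁ ⥤ D₁) (p₂ : C₂ ⥤ D₂) (Ψ : C₁ ≌ C₂) (Θ : D₁ ≌ D₂) : Type (max u₁ v₄) :=
  Ψ.functor ⋙ p₂ ≅ p₁ ⋙ Θ.functor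

variable {p₁ : C₁ ⥤ D₁} {p₂ : C₂ ⥤ D₂}

/-- `LiesUnder` is invariant under isomorphism of the upper equivalence. ([IUTchI] Cor 5.3 p.144) [claim: Mochizuki2012, status: disputed] -/
def LiesUnder.ofIsoUpper {Ψ Ψ' : C₁ ≌ C₂} {Θ : D₁ ≌ D₂} (h : LiesUnder p₁ p₂ Ψ Θ)
    (i : Ψ.functor ≅ Ψ'.functor) : LiesUnder p₁ p₂ Ψ' Θ :=
  (Functor.isoWhiskerRight i p₂).symm ≪≫ h

/-- `LiesUnder` is invariant under isomorphism of the lower equivalence. ([IUTchI] Cor 5.3 p.144) [claim: Mochizuki2012, status: disputed] -/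
def LiesUnder.ofIsoLower {Ψ : C₁ ≌ C₂} {Θ Θ' : D₁ ≌ D₂} (h : LiesUnder p₁ p₂ Ψ Θ)
    (j : Θ.functor ≅ Θ'.functor) : LiesUnder p₁ p₂ Ψ Θ' :=
  h ≪≫ Functor.isoWhiskerLeft p₁ j

variable (p₁ p₂)

/-- EXISTENCE hypothesis for the natural map: under every equivalence `C₁ ⥲ C₂` lies some equivalence
`D₁ ⥲ D₂` (for Frobenioids: [FrdI] Thm 3.4 (i) / Cor 4.11 (i) "`Base(−)` is category-theoretic"; a
displayed binder, never asserted here). ([IUTchI] Cor 5.3 p.144) [claim: Mochizuki2012, status: disputed] -/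
def HasUnder : Prop := ∀ Ψ : C₁ ≌ C₂, ∃ Θ : D₁ ≌ D₂, Nonempty (LiesUnder p₁ p₂ Ψ Θ)

/-- UNIQUENESS hypothesis for the natural map: two equivalences lying under the same `Ψ` are isomorphic
(for Frobenioids: [FrdI] Cor 4.11 (iv), the essential uniqueness of `Ψ^Base`; a displayed binder).
([IUTchI] Cor 5.3 p.144) [claim: Mochizuki2012, status: disputed] -/
def UnderUnique : Prop :=
  ∀ (Ψ : C₁ ≌ C₂) (Θ Θ' : D₁ ≌ D₂), Nonempty (LiesUnder p₁ p₂ Ψ Θ) → Nonempty (LiesUnder p₁ p₂ Ψ Θ') →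
    Nonempty (Θ.functor ≅ Θ'.functor)

variable {p₁ p₂}

/-- Under `HasUnder` and `UnderUnique`, the class of the equivalence lying under `Ψ` depends only on the
class of `Ψ`. ([IUTchI] Cor 5.3 p.144) [claim: Mochizuki2012, status: disputed] -/
theorem descend_wd (hu : UnderUnique p₁ p₂) {Ψ Ψ' : C₁ ≌ C₂} {Θ Θ' : D₁ ≌ D₂}
    (h : Nonempty (LiesUnder p₁ p₂ Ψ Θ)) (h' : Nonempty (LiesUnder p₁ p₂ Ψ' Θ'))
    (i : Nonempty (Ψ.functor ≅ Ψ'.functor)) : CatIsomorphism.mk Θ = CatIsomorphism.mk Θ' := by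
  obtain ⟨h⟩ := h
  obtain ⟨i⟩ := i
  obtain ⟨j⟩ := hu Ψ' Θ Θ' ⟨h.ofIsoUpper i⟩ h'
  exact sound j

/-- **The natural map `Isom(C₁, C₂) → Isom(D₁, D₂)`** of [IUTchI] Cor 5.3 ("`ⁱ𝔉 ↦ ⁱ𝔇` … the natural map
`Isom(¹𝔉, ²𝔉) → Isom(¹𝔇, ²𝔇)`"; (i) `Isom(ⁱℱ^⊛) → Isom(Base(ⁱℱ^⊛))`; (iv) `Aut(ℱ̲_v) → Aut(𝒟_v)`): the class of
`Ψ` goes to the class of the (essentially unique) equivalence lying under `Ψ`.  Defined from the two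
displayed hypotheses `HasUnder` (existence) and `UnderUnique` (uniqueness); nothing is asserted.
([IUTchI] Cor 5.3 p.144) [claim: Mochizuki2012, status: disputed] -/
noncomputable def descend (he : HasUnder p₁ p₂) (hu : UnderUnique p₁ p₂) :
    CatIsomorphism C₁ C₂ → CatIsomorphism D₁ D₂ :=
  Quotient.lift (s := equivSetoid C₁ C₂) (fun Ψ => CatIsomorphism.mk (he Ψ).choose)
    fun Ψ Ψ' (i : Nonempty (Ψ.functor ≅ Ψ'.functor)) =>
      descend_wd hu (he Ψ).choose_spec (he Ψ').choose_spec i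

/-- The natural map on representatives: if `Θ` lies under `Ψ` then `descend [Ψ] = [Θ]`.
([IUTchI] Cor 5.3 p.144) [claim: Mochizuki2012, status: disputed] -/
theorem descend_mk (he : HasUnder p₁ p₂) (hu : UnderUnique p₁ p₂) {Ψ : C₁ ≌ C₂} {Θ : D₁ ≌ D₂}
    (h : Nonempty (LiesUnder p₁ p₂ Ψ Θ)) : descend he hu (CatIsomorphism.mk Ψ) = CatIsomorphism.mk Θ := by
  change CatIsomorphism.mk (he Ψ).choose = CatIsomorphism.mk Θ
  exact descend_wd hu (he Ψ).choose_spec h ⟨Iso.refl _⟩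

end Descend

section DescendComp

variable {C₁ : Type u₁} [Category.{v₁} C₁] {C₂ : Type u₂} [Category.{v₂} C₂] {C₃ : Type u₃} [Category.{v₃} C₃]
  {D₁ : Type u₄} [Category.{v₄} D₁] {D₂ : Type u₅} [Category.{v₅} D₂] {D₃ : Type u₆} [Category.{v₆} D₃]
  {p₁ : C₁ ⥤ D₁} {p₂ : C₂ ⥤ D₂} {p₃ : C₃ ⥤ D₃}

/-- If `Θ` lies under `Ψ` and `Θ'` under `Ψ'`, then `Θ.trans Θ'` lies under `Ψ.trans Ψ'` (pasting of the two
squares). ([IUTchI] Cor 5.3 p.144) [claim: Mochizuki2012, status: disputed] -/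
def LiesUnder.trans {Ψ : C₁ ≌ C₂} {Θ : D₁ ≌ D₂} {Ψ' : C₂ ≌ C₃} {Θ' : D₂ ≌ D₃}
    (h : LiesUnder p₁ p₂ Ψ Θ) (h' : LiesUnder p₂ p₃ Ψ' Θ') :
    LiesUnder p₁ p₃ (Ψ.trans Ψ') (Θ.trans Θ') :=
  Functor.associator Ψ.functor Ψ'.functor p₃ ≪≫ Functor.isoWhiskerLeft Ψ.functor h' ≪≫
    (Functor.associator Ψ.functor p₂ Θ'.functor).symm ≪≫ Functor.isoWhiskerRight h Θ'.functor ≪≫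
    Functor.associator p₁ Θ.functor Θ'.functor

/-- The identity lies under the identity. ([IUTchI] Cor 5.3 p.144) [claim: Mochizuki2012, status: disputed] -/
def LiesUnder.refl (p : C₁ ⥤ D₁) :
    LiesUnder p p (CategoryTheory.Equivalence.refl (C := C₁)) (CategoryTheory.Equivalence.refl (C := D₁)) :=
  p.leftUnitor ≪≫ p.rightUnitor.symm

/-- **The natural map is compatible with composition**: `descend ([Ψ] ∘ [Ψ']) = descend [Ψ] ∘ descend [Ψ']`
(so on `Aut(−)` it is a homomorphism of groups — "the natural homomorphism `Aut(ℱ̲_v) → Aut(𝒟_v)`",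
Cor 5.3 (iv)). ([IUTchI] Cor 5.3 p.144) [claim: Mochizuki2012, status: disputed] -/
theorem descend_comp (he₁₂ : HasUnder p₁ p₂) (hu₁₂ : UnderUnique p₁ p₂) (he₂₃ : HasUnder p₂ p₃)
    (hu₂₃ : UnderUnique p₂ p₃) (he₁₃ : HasUnder p₁ p₃) (hu₁₃ : UnderUnique p₁ p₃)
    (a : CatIsomorphism C₁ C₂) (b : CatIsomorphism C₂ C₃) :
    descend he₁₃ hu₁₃ (a.comp b) = (descend he₁₂ hu₁₂ a).comp (descend he₂₃ hu₂₃ b) := by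
  obtain ⟨Ψ, rfl⟩ := mk_surjective a
  obtain ⟨Ψ', rfl⟩ := mk_surjective b
  obtain ⟨Θ, ⟨h⟩⟩ := he₁₂ Ψ
  obtain ⟨Θ', ⟨h'⟩⟩ := he₂₃ Ψ'
  rw [descend_mk he₁₂ hu₁₂ ⟨h⟩, descend_mk he₂₃ hu₂₃ ⟨h'⟩, mk_comp_mk, mk_comp_mk,
    descend_mk he₁₃ hu₁₃ ⟨h.trans h'⟩]

/-- The natural map sends the identity to the identity. ([IUTchI] Cor 5.3 p.144) [claim: Mochizuki2012, status: disputed] -/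
theorem descend_refl {p : C₁ ⥤ D₁} (he : HasUnder p p) (hu : UnderUnique p p) :
    descend he hu (CatIsomorphism.refl C₁) = CatIsomorphism.refl D₁ := by
  rw [refl_eq_mk, refl_eq_mk, descend_mk he hu ⟨LiesUnder.refl p⟩]

end DescendComp

/-! ### Reading of Corollary 5.3 in this currency -/

section Reading

variable {C₁ : Type u₁} [Category.{v₁} C₁] {C₂ : Type u₂} [Category.{v₂} C₂]
  {D₁ : Type u₃} [Category.{v₃} D₁] {D₂ : Type u₄} [Category.{v₄} D₂]
  (p₁ : C₁ ⥤ D₁) (p₂ : C₂ ⥤ D₂)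

/-- The shape of [IUTchI] Cor 5.3 (i), (ii), (iv) for ONE pair of categories over bases: "the natural map
`Isom(C₁, C₂) → Isom(D₁, D₂)` is bijective" — given that the natural map exists (`HasUnder`,
`UnderUnique`).  A PREDICATE on the data (definition with parameters), not a named fact; the printed
corollary asserts it for the reference Frobenioids of Examples 3.2–3.5 / 5.1, which is NOT done here.
([IUTchI] Cor 5.3 p.144) [claim: Mochizuki2012, status: disputed] -/
def DescendBijective (he : HasUnder p₁ p₂) (hu : UnderUnique p₁ p₂) : Prop :=
  Function.Bijective (descend he hu)

variable {p₁ p₂}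

/-- Bookkeeping: bijective = injective ("an isomorphism of `ℱ`'s lying over [the class of] an isomorphism of
`𝒟`'s is unique", the rigidity half) ∧ surjective ("every isomorphism of `𝒟`'s lifts", the half print
derives "from the construction"). ([IUTchI] Cor 5.3 p.144) [claim: Mochizuki2012, status: disputed] -/
theorem descendBijective_iff_injective_and_surjective (he : HasUnder p₁ p₂) (hu : UnderUnique p₁ p₂) :
    DescendBijective p₁ p₂ he hu ↔
      Function.Injective (descend he hu) ∧ Function.Surjective (descend he hu) :=
  Iff.rfl

/-- SURJECTIVITY criterion in terms of representatives: the natural map is surjective as soon as every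
equivalence of the bases has SOME equivalence of the categories over it (print, Cor 5.3 (iv):
"surjectivity follows immediately from the construction of `ℱ̲_v`").
([IUTchI] Cor 5.3 p.144) [claim: Mochizuki2012, status: disputed] -/
theorem descend_surjective_of_lifts (he : HasUnder p₁ p₂) (hu : UnderUnique p₁ p₂)
    (hlift : ∀ Θ : D₁ ≌ D₂, ∃ Ψ : C₁ ≌ C₂, Nonempty (LiesUnder p₁ p₂ Ψ Θ)) :
    Function.Surjective (descend he hu) := by
  intro b
  obtain ⟨Θ, rfl⟩ := mk_surjective b
  obtain ⟨Ψ, h⟩ := hlift Θ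
  exact ⟨CatIsomorphism.mk Ψ, descend_mk he hu h⟩

/-- INJECTIVITY criterion in terms of representatives: the natural map is injective as soon as two
equivalences of the categories lying over ISOMORPHIC equivalences of the bases are isomorphic (print,
Cor 5.3 (iv): "it remains to verify injectivity … let `α ∈ Ker(Aut(ℱ̲_v) → Aut(𝒟_v))` …").
([IUTchI] Cor 5.3 p.144) [claim: Mochizuki2012, status: disputed] -/
theorem descend_injective_of_rigid (he : HasUnder p₁ p₂) (hu : UnderUnique p₁ p₂)
    (hrigid : ∀ (Ψ Ψ' : C₁ ≌ C₂) (Θ Θ' : D₁ ≌ D₂), Nonempty (LiesUnder p₁ p₂ Ψ Θ) →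
      Nonempty (LiesUnder p₁ p₂ Ψ' Θ') → Nonempty (Θ.functor ≅ Θ'.functor) →
      Nonempty (Ψ.functor ≅ Ψ'.functor)) :
    Function.Injective (descend he hu) := by
  intro a a' hab
  obtain ⟨Ψ, rfl⟩ := mk_surjective a
  obtain ⟨Ψ', rfl⟩ := mk_surjective a'
  obtain ⟨Θ, h⟩ := he Ψ
  obtain ⟨Θ', h'⟩ := he Ψ'
  rw [descend_mk he hu h, descend_mk he hu h'] at hab
  obtain ⟨i⟩ := hrigid Ψ Ψ' Θ Θ' h h' ((mk_eq_mk_iff Θ Θ').1 hab)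
  exact sound i

end Reading

/-! ### `Aut(C) → Aut(D)` as a homomorphism of groups; the one-object kinds -/

section AutHom

variable {C : Type u₁} [Category.{v₁} C] {D : Type u₂} [Category.{v₂} D] {p : C ⥤ D}

/-- **"The natural homomorphism `Aut(ℱ̲_v) → Aut(𝒟_v)`"** ([IUTchI] Cor 5.3 (iv) p. 144; Ex 3.2 (vi) (d)): the
descended map on `Aut(−)` is a homomorphism of groups (from `descend_comp`, `descend_refl`), under the
displayed binders. ([IUTchI] Cor 5.3 p.144) [claim: Mochizuki2012, status: disputed] -/
noncomputable def descendHom (he : HasUnder p p) (hu : UnderUnique p p) : CatAut C →* CatAut D where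
  toFun := descend he hu
  map_one' := by rw [CatAut.one_def, CatAut.one_def, descend_refl]
  map_mul' a b := by rw [CatAut.mul_def, CatAut.mul_def, descend_comp he hu he hu he hu]

/-- `descendHom` is `descend` on elements. ([IUTchI] Cor 5.3 p.144) [claim: Mochizuki2012, status: disputed] -/
@[simp] theorem descendHom_apply (he : HasUnder p p) (hu : UnderUnique p p) (a : CatAut C) :
    descendHom he hu a = descend he hu a := rfl

/-- Cor 5.3 (iv)'s bijectivity in group-homomorphism form is `DescendBijective`.
([IUTchI] Cor 5.3 p.144) [claim: Mochizuki2012, status: disputed] -/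
theorem descendHom_bijective_iff (he : HasUnder p p) (hu : UnderUnique p p) :
    Function.Bijective (descendHom he hu) ↔ DescendBijective p p he hu :=
  Iff.rfl

/-- **The kind of `C` as a one-object groupoid** (§0 p. 33 "isomorphs"; the shape of abc-iut-L5-t2's
`HodgeTheaterModel.Loc v` / abc-iut-L5-t4's `FKit.FAmb v`): Mathlib's `SingleObj (Aut(C))`, whose
endomorphisms (all invertible) are the isomorphisms of categories `C → C`.  The passage `C ↦ Base(C)` on
kinds is the functor of the homomorphism `descendHom`. ([IUTchI] §0 p.33) [claim: Mochizuki2012, status: disputed] -/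
noncomputable def kindFunctor (he : HasUnder p p) (hu : UnderUnique p p) :
    SingleObj (CatAut C) ⥤ SingleObj (CatAut D) :=
  SingleObj.mapHom (CatAut C) (CatAut D) (descendHom he hu)

/-- On endomorphisms of the unique object, `kindFunctor` is `descend`. ([IUTchI] §0 p.33) [claim: Mochizuki2012, status: disputed] -/
theorem kindFunctor_map (he : HasUnder p p) (hu : UnderUnique p p)
    (a : SingleObj.star (CatAut C) ⟶ SingleObj.star (CatAut C)) :
    (kindFunctor he hu).map a = descend he hu a := rfl

end AutHom

end CatIsomorphism

end Literature.IUT.HodgeTheaters
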